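import Summits.RiemannHypothesis.RiemannHypothesis.Theorems.LiTailLaguerreLiPrimeTailLaguerre
import Summits.RiemannHypothesis.RiemannHypothesis.Theorems.LiTailLaguerreLiGammaTailShift
import Summits.RiemannHypothesis.RiemannHypothesis.Theorems.LiTailLaguerreAssembly
import Summits.RiemannHypothesis.RiemannHypothesis.Theorems.LiTailLaguerreCompanions
import HarnessLib

/-!
# RiemannHypothesis / LiTailLaguerre — the rung leaf «Li TAIL–LAGUERRE LAW» `LiTheory.LiZeroTailLaguerre` is a tree
# theorem (RH-FREE, PROOF-OF-DATA, NOT height-buying)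

RH-FREE [rh-li-prover g5].  Route `Theses/LiTailLaguerre.lean` (route-RiemannHypothesis-LiTailLaguerre, round 7 of the
LI column, theory g9; rung L-P(P1-tail)).  Every binder of the route is CLOSED·proved in the tree:
K1′ `liTailContour_proof` (eng g5), K2′ `liPrimeTailLaguerre_proof` (prover g5, DECIDING), K3′ `liGammaTailShift_proof`
(eng-2 g4), K4′ `liTailHorizontal_proof` (tail-p2 g0), `liTailLaguerre_assembly_proof` (eng-4 g5).  THIS FILE composes
them with the planner's deciding theorem `Theses.LiTailLaguerre.closes`:

  `liZeroTailLaguerre_proof : LiTheory.LiZeroTailLaguerre` — for every fixed `c > 0` with `log m ≠ 1/c²` for all prime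
  powers `m` there is `C_c` with, for all `n ≥ 2`,
  `|liZeroTail n (c√n) − liSmoothTail n (c√n) + Σ_{2 ≤ m ≤ ⌊e^{1/c²}⌋} liCoffeyTerm m n| ≤ C_c log² n`,

and records one more PROVED companion, PART D's SILENT WINDOW `liZeroWindowSilent_holds` (for `1 < c ≤ 23/20` the window
`(√n, c√n]` releases no prime power), via eng-4 g5's glue `liZeroWindowSilent_of_laguerre`; the tail companions
`liZeroTailSilent_holds` / `liZeroTailEcho_holds` are already in `Theorems/LiTailLaguerreCompanionsHold.lean`.
LABELS: RH-FREE for all `n`; a distinct statement about the finite explicit-formula bookkeeping of the zeros ABOVE height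
`c√n` (every zero summed whatever its real part); nothing here bears on the truth of RH.
-/

noncomputable section

-- D-0017: `Summit.<S>.<S>.…` is the designed namespace of a single-problem summit.
set_option linter.dupNamespace false

namespace Summit.RiemannHypothesis.RiemannHypothesis.Theorems.LiTheory

open Summit.RiemannHypothesis.RiemannHypothesis.Theses.LiTailLaguerre

/-- **The Li TAIL–LAGUERRE LAW** (rung leaf `LiTheory.LiZeroTailLaguerre`, RH-FREE, PROOF-OF-DATA): the composition of the
five closed binders of route `LiTailLaguerre` by the planner's deciding theorem `closes`. -/
theorem liZeroTailLaguerre_proof : LiZeroTailLaguerre :=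
  closes liPrimeTailLaguerre_proof liTailContour_proof liGammaTailShift_proof liTailHorizontal_proof
    liTailLaguerre_assembly_proof

/-- **SILENT WINDOW** (PART D companion `LiTheory.LiZeroWindowSilent`, RH-FREE, now unconditional): for `1 < c ≤ 23/20` the
windowed Li trace over `(√n, c√n]` equals its smooth mean up to `C_c log² n` — eng-4 g5's glue
`liZeroWindowSilent_of_laguerre` applied to the law. -/
theorem liZeroWindowSilent_holds : LiZeroWindowSilent :=
  liZeroWindowSilent_of_laguerre liZeroTailLaguerre_proof

end Summit.RiemannHypothesis.RiemannHypothesis.Theorems.LiTheory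

end
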